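import Summits.QuantumFields.BalabanUV.T4Continuum.Support.NE9LevelCountsRecordFive

/-!
# NE9SpeciesFrameOfRecord — THE INDEX FRAME OF RECORD of the species data (O-NE9-1 item (ii), the NE9 owner's part): boxes,
# anchors `□̃⁴`, windows `□̃²`, the connected families `Y₀` with `Y₀ ∪ □̃⁵ = Y`, the sources `X ∈ 𝐃_j, X ⊂ □̃²` (re∕im doubled),
# the counting cubes `□′` and their fibres — CONSTRUCTED on the carriers of record, and the species LEVEL COUNTS `LevelCountsG`
# ([II] (1.26)–(1.28)) for that frame with ALL FIVE FIELDS KERNEL AND NO IDENTIFICATION BINDER LEFT (letters only: κ ≥ 144,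
# κ₁ ≥ 69, 0 ≤ θ, L⁴θ⁵ ≤ ω, 5⁴ ≤ c_Q) — cell `pub-balaban`, T4-DAG §2 node U3 ∕ §6 NE9; BINDER row NE9 OWNER lineage
# `b2b-balaban-t4-ne9-p1`, generation 36 (CARVER-NOTES g33 §4 (a) ∕ g34 §3 «the FIRST buildable item of O-NE9-1 (ii): the
# frames-only species datum on the torus carriers so that the counting binders hold by construction»); nothing of any import modified

HONEST FRAMING (T4-DAG PAGE 1).  Rung (B)+1 of the FINITE-VOLUME T⁴ programme — NOT infinite volume, NOT a mass gap, NOT the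
Clay problem.  NE9 (`T4OutputRate.NE9` ∧ `FadingMemory`) is a cell NEW ESTIMATE, NOT PRINTED in [I] = [Balaban1987RG1]
(CMP **109**), [II] = [Balaban1988RG2Cluster] (CMP **116**), and NOT PROVED for Bałaban's E^{(j)} («NE9 ⇐ the named binders»;
spine PROVED 0∕9).  HONEST DEPENDENCY (cell line, verbatim): continuum YM on T⁴ ⇐ BetaPertH ∧ nine spine estimates (0/9 proved);
BetaPertH ⇐ (D1) ∧ (D4) ∧ CAP+tail; G-an2-4 gates asym, D1 and NE2/3/4.  `FlowStep.BetaPertH`, (B), (B^μ) do not occur.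
LATTICE BOOKKEEPING on the cell's torus model; [I]∕[II] are quoted for the TYPES of the index sets only (ABSOLUTE RULE: nothing
printed in the audited series is asserted); no activity, no history, no analytic datum — the slice curves `cur`, kernels `ker`,
radii `R ∕ ϱ ∕ r`, `κ₁` and the contour lists stay the species' own fields (WALL-NE9-P1 §3 (ii)); 0 sorry.

WHAT WAS DISPLAYED, WHAT IS NOW CONSTRUCTED.  Every species END of row NE9 (`…realRow` p225379 down to the species leaves) displays
the level counts `hLa ∕ hLb : LevelCountsG (D U).toC.frame κ κ₁ O1 c_Q gain ℓ`; the crew made all five fields kernel on the carriers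
of record MODULO IDENTIFICATION READINGS (`NE9LevelCountsRecordFive.levelCountsG_of_record₅`, leaf-01-g8: readings `rd hd hm rq hSX
Yout hS0 hdY Anc dom hinjY hdom hAnc hvol W hW hinj hrq hsrc hsurj hSXsup` — «the readings of a species frame on Bałaban's (1.33)
objects — which domains, which window □̃₀², which anchor □̃⁴ — are O-NE9-1 and are NOT decided here»).  THIS FILE DECIDES THEM,
reading [II] pp. 4–8 and [I] p. 273 on the ×2 renders (`b2b-balaban-ref1/pages/…`):
* the centre cube `□ ∈ π_k`, `□ ⊂ Y` ([II] (1.28) p. 8 «the sum over □₀ can be bounded by M⁻⁴|Y|»; [I] p. 273 «the cube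
  □₀ = □̃⁵») — `boxes R k Y := (footprint Y).filter (·.1 = k)`;
* the sup-metric enlargements `□̃ⁿ` on the torus of scale-`k` cubes — `cubeBall n c` (`card ≤ (2n+1)⁴`, `mem_cubeBall_self`):
  anchor `□̃⁴` (`anchor`, ≤ 6561 cubes), window `□̃²` (`window`, ≤ 625 cubes), `□₀ = □̃⁵` (`box5`);
* the families `Y₀`: torus-face-connected families of scale-`k` cubes with `□̃⁴ ⊆ Y₀` and `Y₀ ∪ □̃⁵ = Y` ([II] p. 4 «We denote
  by Y₀ the connected component of the domain Y(σ) containing the cube □̃⁴», p. 7 «where Y = Y₀ ∪ □₀. Of course Y is a localization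
  domain form 𝐃_k»), embedded as finsets of sigma cubes — `families R k Y a`; the paid volume `M⁻⁴|Y₀ ∖ □̃⁴|` — `vol R k a b`;
* the sources `X ∈ 𝐃_j, X ⊂ □̃²`, `j ≤ k` ([II] p. 8 l. 1–2), on the DOUBLED carriers (re∕im copies, `NE9ComplexEncoding`) —
  `sources R k a j` (cross-level inclusion by `B13InnerData.coarsen`, as the tree's `Within`); the counting cubes `□′ ∈ π_j, □′ ⊂ □̃²`
  — `countingCubes R k a j` — and the fibres `X ⊃ □′` — `fibre R k a j q` ([II] (1.26) p. 8);
* the output size letter `dY := 1 + d_k(Y)` (the `+1` is «LC-REC»'s located repair of the zero-size corner of (1.28), p215967).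
THEN **`levelCountsG_of_frameOfRecord`**: for ANY piece frame `P` over the doubled carriers of record whose seven index fields ARE
these (seven definitional equations — `rfl`∕`Finset.length_toList` at a species datum built on this frame) and any output reading
`Yout : ℕ → ι → 𝐃` (the table-coordinate type `ι` stays the instancer's), `LevelCountsG P κ κ₁ (2·(2²⁰+1)) c_Q (agePow θ)⁵ (agePow ω)`
from the five letters alone — «LC-REC» + «LC-127» + «LC-WINDOW» composed BY NAME with every reading discharged BY CONSTRUCTION
(`rd := Prod.fst`, multiplicity 2; `rq := cubeAt`; `dom := cubesOf`; injectivity of the embeddings; the window's surjection).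
ALSO (for the species' G1 binder `dY ≤ d₀ + 4·vol` at this frame): **`card_cubesAt_le_vol`** — `Y₀ ∪ □̃⁵ = Y` gives
`#cubes_k(Y) ≤ vol + 6561 + 14641`, so with `TreeLengthTorus.torusTreeLen_le_card_sub_one` the instancer's G1 holds with
`d₀ = 21203` (recorded as `one_add_d_le_vol` for outputs of scale `k`).
DISGUISE TEST: finite-set bookkeeping; the one modelling decision is WHICH index sets (displayed above with loci, open to objection
by the substrate ∕ NE5 ∕ referees exactly like the substrate's SHAPE postings); no inequality of the series; not NE9, not NE5.

References (TYPES ∕ loci only): T. Bałaban, *Renormalization group approach to lattice gauge field theories. II. Cluster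
expansions*, Commun. Math. Phys. **116** (1988) 1–22 [Balaban1988RG2Cluster], pp. 4, 7–8, (1.23)–(1.28); *I*, Commun. Math. Phys.
**109** (1987) 249–301 [Balaban1987RG1], p. 273 («□₀ = □̃⁵», «X ⊂ □̃²»).  Summits-side NEW work (LEAN PLACEMENT RULE); imports
«LC-RECORD-FIVE» `NE9LevelCountsRecordFive` (p217086) ONLY; modifies nothing.  Value = O-NE9-1 item (ii)'s index frame decided and
its counting side closed in the kernel with letters only — bookkeeping on the row's instantiation path, NOT summit progress.
-/

noncomputable section

open scoped BigOperators

namespace Summit.QuantumFields.BalabanUV.T4Continuum.NE9SpeciesFrameOfRecord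

open Literature.MathematicalPhysics.QuantumFieldTheory.Balaban1983to89
open Literature.MathematicalPhysics.QuantumFieldTheory.Balaban1983to89.T4OutputRate (Carriers)
open Literature.MathematicalPhysics.QuantumFieldTheory.Balaban1983to89.TreeLengthTorus (TPt TFaceConnected TDom)
open Summit.QuantumFields.BalabanUV.T4Continuum.B13Carriers (TwoRuns)
open Summit.QuantumFields.BalabanUV.T4Continuum.B13DomainGeometryTR
open Summit.QuantumFields.BalabanUV.T4Continuum.B13InnerData (coarsen)
open Summit.QuantumFields.BalabanUV.T4Continuum.NE9ComplexEncoding (doubleCarriers)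
open Summit.QuantumFields.BalabanUV.T4Continuum.NE9Lemma1Counting
open Summit.QuantumFields.BalabanUV.T4Continuum.NE9Lemma1Gain
open Summit.QuantumFields.BalabanUV.T4Continuum.NE9LevelCountsRecord (multiplicity_fst_le_two)
open Summit.QuantumFields.BalabanUV.T4Continuum.NE9LevelCountsRecordFive (levelCountsG_of_record₅_agePow)

/-! ## §1 The enlargements `□̃ⁿ` on a torus of cubes -/

section Torus

variable {N : ℕ}

/-- [folklore] DATA: **`□̃ⁿ`** — the sup-metric ball of radius `n` (in cubes) around the cube `c` on the torus `(ℤ/N)⁴` of cube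
indices: all `c + v − n·𝟙` with `v ∈ {0,…,2n}⁴` ([Balaban1988RG2Cluster] p. 4 «the cube □̃⁴», p. 8 «□′ ⊂ □̃²»; [Balaban1987RG1]
p. 273 «□₀ = □̃⁵»). -/
def cubeBall (n : ℕ) (c : TPt 4 N) : Finset (TPt 4 N) :=
  (Finset.univ : Finset (Fin 4 → Fin (2 * n + 1))).image fun v i => c i + ((v i : ℕ) : ZMod N) - (n : ZMod N)

/-- [folklore] `#□̃ⁿ ≤ (2n+1)⁴`. -/
theorem card_cubeBall_le (n : ℕ) (c : TPt 4 N) : (cubeBall n c).card ≤ (2 * n + 1) ^ 4 := by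
  refine Finset.card_image_le.trans ?_
  simp [Finset.card_univ, Fintype.card_pi]

/-- [folklore] The centre lies in its enlargement. -/
theorem mem_cubeBall_self (n : ℕ) (c : TPt 4 N) : c ∈ cubeBall n c := by
  refine Finset.mem_image.2 ⟨fun _ => ⟨n, by omega⟩, Finset.mem_univ _, ?_⟩
  funext i
  simp

/-- [folklore] `□̃ⁿ` is nonempty. -/
theorem cubeBall_nonempty (n : ℕ) (c : TPt 4 N) : (cubeBall n c).Nonempty := ⟨c, mem_cubeBall_self n c⟩

end Torus

/-! ## §2 The index frame of record on the carriers of record -/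

section Record

variable {G : Type} [GaugeGroup G] (R : TwoRuns G)

/-- [folklore] DATA: the scale-`k` cube index named by a sigma cube (junk `0` off the scale `k`). -/
def cubeAt (k : ℕ) (a : SCube R) : TPt 4 (R.cubesPerDir k) := if h : a.1 = k then h ▸ a.2 else 0

/-- [folklore] `cubeAt k ⟨k, p⟩ = p`. -/
@[simp] theorem cubeAt_mk (k : ℕ) (p : TPt 4 (R.cubesPerDir k)) : cubeAt R k ⟨k, p⟩ = p := by
  simp [cubeAt]

/-- [folklore] DATA: the scale-`k` cubes of a finset of sigma cubes. -/
def cubesOf (k : ℕ) (b : Finset (SCube R)) : Finset (TPt 4 (R.cubesPerDir k)) :=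
  Finset.univ.filter fun p => (⟨k, p⟩ : SCube R) ∈ b

/-- [folklore] Membership in `cubesOf`. -/
@[simp] theorem mem_cubesOf {k : ℕ} {b : Finset (SCube R)} {p : TPt 4 (R.cubesPerDir k)} :
    p ∈ cubesOf R k b ↔ (⟨k, p⟩ : SCube R) ∈ b := by
  simp [cubesOf]

/-- [folklore] `cubesOf k` inverts the embedding of scale-`k` families. -/
@[simp] theorem cubesOf_map_embed (k : ℕ) (S : Finset (TPt 4 (R.cubesPerDir k))) : cubesOf R k (S.map (embed R k)) = S := by
  ext p
  rw [mem_cubesOf, Finset.mem_map]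
  constructor
  · rintro ⟨q, hq, h⟩
    have hqp : q = p := eq_of_heq (Sigma.mk.inj h).2
    exact hqp ▸ hq
  · intro hp
    exact ⟨p, hp, rfl⟩

/-- [folklore] DATA: **THE BOXES** — the scale-`k` cubes `□` of the output domain `Y` ([Balaban1988RG2Cluster] (1.28) p. 8 «the sum
over □₀ can be bounded by M⁻⁴|Y|»; empty unless `Y ∈ 𝐃_k`). -/
def boxes (k : ℕ) (Y : R.carriers.Dom) : Finset (SCube R) := (footprint Y).filter fun c => c.1 = k

/-- [folklore] DATA: **THE ANCHOR `□̃⁴`** of a box ([Balaban1988RG2Cluster] p. 4). -/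
def anchor (k : ℕ) (a : SCube R) : Finset (TPt 4 (R.cubesPerDir k)) := cubeBall 4 (cubeAt R k a)

/-- [folklore] DATA: **THE WINDOW `□̃²`** of a box ([Balaban1988RG2Cluster] p. 8 «X ⊂ □̃²», «□′ ⊂ □̃²»). -/
def window (k : ℕ) (a : SCube R) : Finset (TPt 4 (R.cubesPerDir k)) := cubeBall 2 (cubeAt R k a)

/-- [folklore] DATA: **THE CUBE `□₀ = □̃⁵`** of a box ([Balaban1987RG1] p. 273). -/
def box5 (k : ℕ) (a : SCube R) : Finset (TPt 4 (R.cubesPerDir k)) := cubeBall 5 (cubeAt R k a)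

/-- [folklore] The embedding of scale-`k` families of cubes as finsets of sigma cubes. -/
def familyEmb (k : ℕ) : Finset (TPt 4 (R.cubesPerDir k)) ↪ Finset (SCube R) :=
  ⟨fun S => S.map (embed R k), Finset.map_injective (embed R k)⟩

/-- [folklore] `familyEmb k S = S.map (embed k)`. -/
@[simp] theorem familyEmb_apply (k : ℕ) (S : Finset (TPt 4 (R.cubesPerDir k))) : familyEmb R k S = S.map (embed R k) := rfl

open Classical in
/-- [folklore] DATA: **THE FAMILIES `Y₀`** of a box in the output domain `Y`: torus-face-connected families of scale-`k` cubes
containing the anchor `□̃⁴` with `Y₀ ∪ □̃⁵ = Y` (as families of scale-`k` cubes), embedded as finsets of sigma cubes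
([Balaban1988RG2Cluster] p. 4 «Y₀ the connected component … containing the cube □̃⁴», p. 7 «Y = Y₀ ∪ □₀»). -/
def families (k : ℕ) (Y : R.carriers.Dom) (a : SCube R) : Finset (Finset (SCube R)) :=
  ((Finset.univ : Finset (Finset (TPt 4 (R.cubesPerDir k)))).filter fun S =>
      anchor R k a ⊆ S ∧ TFaceConnected S ∧ S ∪ box5 R k a = cubesOf R k (footprint Y)).map (familyEmb R k)

/-- [folklore] DATA: **THE PAID VOLUME** `M⁻⁴|Y₀ ∖ □̃⁴|` of a family ([Balaban1988RG2Cluster] (1.24)–(1.25) p. 7). -/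
def vol (k : ℕ) (a : SCube R) (b : Finset (SCube R)) : ℝ := ((cubesOf R k b \ anchor R k a).card : ℝ)

/-- [folklore] DATA: **THE SOURCES** `X ∈ 𝐃_j`, `X ⊂ □̃²` (every cube of `X`, coarsened to scale `k`, in the window), on the
DOUBLED carriers (re∕im copies) ([Balaban1988RG2Cluster] p. 8 «We take X ∈ 𝐃_j, X ⊂ □̃²»; [Balaban1987RG1] §1 p. 263). -/
def sources (k : ℕ) (a : SCube R) (j : ℕ) : Finset (R.carriers.Dom × Bool) :=
  if j ≤ k ∧ k + R.m' ≤ R.F.m + R.K then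
    ((R.domAt j).filter fun X => ∀ c ∈ footprint X, coarsen R c.1 k c.2 ∈ window R k a) ×ˢ (Finset.univ : Finset Bool)
  else ∅

/-- [folklore] DATA: **THE COUNTING CUBES** `□′ ∈ π_j`, `□′ ⊂ □̃²` ([Balaban1988RG2Cluster] p. 8), as sigma cubes. -/
def countingCubes (k : ℕ) (a : SCube R) (j : ℕ) : Finset (SCube R) :=
  if j ≤ k ∧ k + R.m' ≤ R.F.m + R.K then
    ((Finset.univ : Finset (TPt 4 (R.cubesPerDir j))).filter fun p => coarsen R j k p ∈ window R k a).map (embed R j)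
  else ∅

/-- [folklore] DATA: **THE FIBRES** `X ∈ 𝐃_j, X ⊃ □′` over a counting cube ([Balaban1988RG2Cluster] (1.26) p. 8). -/
def fibre (k : ℕ) (a : SCube R) (j : ℕ) (q : SCube R) : Finset (R.carriers.Dom × Bool) :=
  (sources R k a j).filter fun x => (⟨j, cubeAt R j q⟩ : SCube R) ∈ footprint x.1

/-! ## §3 The readings, by construction -/

variable {R}

/-- [folklore] A box of scale `k` is a scale-`k` cube of the output's footprint. -/
theorem mem_boxes {k : ℕ} {Y : R.carriers.Dom} {c : SCube R} : c ∈ boxes R k Y ↔ c ∈ footprint Y ∧ c.1 = k := Finset.mem_filter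

/-- [folklore] `#boxes ≤ #footprint` ((1.28)'s count, «LC-REC» `hS0`). -/
theorem card_boxes_le (k : ℕ) (Y : R.carriers.Dom) : (boxes R k Y).card ≤ (footprint Y).card := Finset.card_filter_le _ _

/-- [folklore] The anchor is nonempty and has at most `9⁴ = 6561` cubes («LC-127» `hAnc`). -/
theorem anchor_nonempty_card_le (k : ℕ) (a : SCube R) : (anchor R k a).Nonempty ∧ (anchor R k a).card ≤ 6561 :=
  ⟨cubeBall_nonempty 4 _, (card_cubeBall_le 4 _).trans (by norm_num)⟩

/-- [folklore] The window has at most `5⁴ = 625` cubes («LC-WINDOW» `hW`). -/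
theorem card_window_le (k : ℕ) (a : SCube R) : ((window R k a).card : ℝ) ≤ 625 := by
  have h : (window R k a).card ≤ 625 := (card_cubeBall_le 2 _).trans (by norm_num)
  exact_mod_cast h

/-- [folklore] `□̃⁵` has at most `11⁴ = 14641` cubes. -/
theorem card_box5_le (k : ℕ) (a : SCube R) : (box5 R k a).card ≤ 14641 := (card_cubeBall_le 5 _).trans (by norm_num)

/-- [folklore] Membership in the families of a box (unfolded). -/
theorem mem_families {k : ℕ} {Y : R.carriers.Dom} {a : SCube R} {b : Finset (SCube R)} :
    b ∈ families R k Y a ↔ ∃ S : Finset (TPt 4 (R.cubesPerDir k)),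
      (anchor R k a ⊆ S ∧ TFaceConnected S ∧ S ∪ box5 R k a = cubesOf R k (footprint Y)) ∧ S.map (embed R k) = b := by
  classical
  simp only [families, Finset.mem_map, Finset.mem_filter, Finset.mem_univ, true_and, familyEmb_apply]

/-- [folklore] A family reads back its cube set: `cubesOf k b = S` for `b = S.map (embed k)` («LC-127» `dom`). -/
theorem cubesOf_of_mem_families {k : ℕ} {Y : R.carriers.Dom} {a : SCube R} {b : Finset (SCube R)} (hb : b ∈ families R k Y a) :
    anchor R k a ⊆ cubesOf R k b ∧ (cubesOf R k b).Nonempty ∧ TFaceConnected (cubesOf R k b) ∧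
      cubesOf R k b ∪ box5 R k a = cubesOf R k (footprint Y) := by
  obtain ⟨S, ⟨hA, hC, hU⟩, rfl⟩ := mem_families.1 hb
  rw [cubesOf_map_embed]
  exact ⟨hA, (anchor_nonempty_card_le k a).1.mono hA, hC, hU⟩

/-- [folklore] `cubesOf k` is injective on the families of a box («LC-127» `hinjY`). -/
theorem injOn_cubesOf_families (k : ℕ) (Y : R.carriers.Dom) (a : SCube R) :
    Set.InjOn (cubesOf R k) ↑(families R k Y a) := by
  intro b₁ hb₁ b₂ hb₂ h
  obtain ⟨S₁, -, rfl⟩ := mem_families.1 hb₁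
  obtain ⟨S₂, -, rfl⟩ := mem_families.1 hb₂
  rw [cubesOf_map_embed, cubesOf_map_embed] at h
  rw [h]

/-- [folklore] Membership in the sources (unfolded). -/
theorem mem_sources {k : ℕ} {a : SCube R} {j : ℕ} {x : R.carriers.Dom × Bool} :
    x ∈ sources R k a j ↔ (j ≤ k ∧ k + R.m' ≤ R.F.m + R.K) ∧ x.1 ∈ R.domAt j ∧
      ∀ c ∈ footprint x.1, coarsen R c.1 k c.2 ∈ window R k a := by
  unfold sources
  split_ifs with h
  · rw [Finset.mem_product, Finset.mem_filter]
    simp only [Finset.mem_univ, and_true, h, true_and]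
  · simp only [Finset.notMem_empty, h, false_and]

/-- [folklore] Membership in the counting cubes (unfolded). -/
theorem mem_countingCubes {k : ℕ} {a : SCube R} {j : ℕ} {q : SCube R} :
    q ∈ countingCubes R k a j ↔ (j ≤ k ∧ k + R.m' ≤ R.F.m + R.K) ∧
      ∃ p : TPt 4 (R.cubesPerDir j), coarsen R j k p ∈ window R k a ∧ (⟨j, p⟩ : SCube R) = q := by
  unfold countingCubes
  split_ifs with h
  · simp [h]
  · simp [h]

/-- [folklore] Membership in a fibre (unfolded). -/
theorem mem_fibre {k : ℕ} {a : SCube R} {j : ℕ} {q : SCube R} {x : R.carriers.Dom × Bool} :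
    x ∈ fibre R k a j q ↔ x ∈ sources R k a j ∧ (⟨j, cubeAt R j q⟩ : SCube R) ∈ footprint x.1 := Finset.mem_filter

/-- [folklore] «LC-REC» `hSX`: a fibre element is a scale-`j` domain through its counting cube. -/
theorem fibre_reads (k : ℕ) (a : SCube R) (j : ℕ) (q : SCube R) :
    ∀ x ∈ fibre R k a j q, x.1 ∈ R.domAt j ∧ (⟨j, cubeAt R j q⟩ : SCube R) ∈ footprint x.1 := fun _ hx =>
  ⟨(mem_sources.1 (mem_fibre.1 hx).1).2.1, (mem_fibre.1 hx).2⟩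

/-- [folklore] «LC-WINDOW» `hinj`: `cubeAt j` is injective on the counting cubes. -/
theorem injOn_cubeAt_countingCubes (k : ℕ) (a : SCube R) (j : ℕ) :
    Set.InjOn (cubeAt R j) ↑(countingCubes R k a j) := by
  intro q₁ hq₁ q₂ hq₂ h
  obtain ⟨-, p₁, -, rfl⟩ := mem_countingCubes.1 hq₁
  obtain ⟨-, p₂, -, rfl⟩ := mem_countingCubes.1 hq₂
  rw [cubeAt_mk, cubeAt_mk] at h
  rw [h]

/-- [folklore] «LC-WINDOW» `hrq`: a counting cube is live and sits in the window after coarsening. -/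
theorem countingCubes_reads (k : ℕ) (a : SCube R) (j : ℕ) :
    ∀ q ∈ countingCubes R k a j, j ≤ k ∧ k + R.m' ≤ R.F.m + R.K ∧ coarsen R j k (cubeAt R j q) ∈ window R k a := by
  intro q hq
  obtain ⟨hl, p, hp, rfl⟩ := mem_countingCubes.1 hq
  rw [cubeAt_mk]
  exact ⟨hl.1, hl.2, hp⟩

/-- [folklore] «LC-WINDOW» `hsrc`: a source is live, of scale `j`, inside the window. -/
theorem sources_read (k : ℕ) (a : SCube R) (j : ℕ) :
    ∀ x ∈ sources R k a j, j ≤ k ∧ k + R.m' ≤ R.F.m + R.K ∧ x.1 ∈ R.domAt j ∧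
      ∀ c ∈ footprint x.1, coarsen R c.1 k c.2 ∈ window R k a := by
  intro x hx
  obtain ⟨hl, hd, hw⟩ := mem_sources.1 hx
  exact ⟨hl.1, hl.2, hd, hw⟩

/-- [folklore] «LC-WINDOW» `hsurj`: every scale-`j` cube coarsening into the window IS a counting cube. -/
theorem countingCubes_surj (k : ℕ) (a : SCube R) (j : ℕ) (hjk : j ≤ k) (hk : k + R.m' ≤ R.F.m + R.K)
    (b : TPt 4 (R.cubesPerDir j)) (hb : coarsen R j k b ∈ window R k a) :
    ∃ q ∈ countingCubes R k a j, cubeAt R j q = b :=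
  ⟨⟨j, b⟩, mem_countingCubes.2 ⟨⟨hjk, hk⟩, b, hb, rfl⟩, cubeAt_mk R j b⟩

/-- [folklore] «LC-WINDOW» `hSXsup`: a source through a counting cube lies in that cube's fibre. -/
theorem mem_fibre_of_mem_sources (k : ℕ) (a : SCube R) (j : ℕ) {q : SCube R} {x : R.carriers.Dom × Bool}
    (hx : x ∈ sources R k a j) (hq : (⟨j, cubeAt R j q⟩ : SCube R) ∈ footprint x.1) : x ∈ fibre R k a j q :=
  mem_fibre.2 ⟨hx, hq⟩

/-! ## §4 The level counts of the frame of record — all five fields, letters only -/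

variable (R)

/-- **THE SPECIES LEVEL COUNTS OF THE FRAME OF RECORD** ([II] (1.26)–(1.28)), ALL FIVE FIELDS KERNEL, LETTERS ONLY.  For any piece
frame `P` over the doubled carriers of record whose index fields ARE the frame of record (`boxes ∕ families ∕ sources ∕ countingCubes
∕ fibre ∕ vol`, the output domain read by `Yout`, the size letter `≥ 1 + d_k(Y)`): `LevelCountsG P κ κ₁ (2·(2²⁰+1)) c_Q (agePow θ)⁵
(agePow ω)` for `κ ≥ 144`, `κ₁ ≥ 69`, `0 ≤ θ`, `L⁴θ⁵ ≤ ω`, `625 ≤ c_Q` — «LC-RECORD-FIVE» (`levelCountsG_of_record₅_agePow`) with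
every identification reading DISCHARGED BY CONSTRUCTION (`rd := Prod.fst` of multiplicity 2, `rq := cubeAt`, `dom := cubesOf`,
`Anc := anchor`, `W := window`).  The constants are the cell's certified ones (O1 = 2·(2²⁰+1) at κ ≥ 144, κ₁ ≥ 69, (6L)⁴-type count
through `625 ≤ c_Q`), NOT print's unspecified O(1) «for κ sufficiently large». [cite: Balaban1988RG2Cluster, (1.26)-(1.28) p.8] -/
theorem levelCountsG_of_frameOfRecord {Bg ι : Type}
    (P : PieceData (doubleCarriers R.carriers) Bg ι (SCube R) (Finset (SCube R)) (SCube R)) (Yout : ℕ → ι → R.carriers.Dom)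
    (hS0 : ∀ k y, P.S0 k y = boxes R k (Yout k y)) (hSY : ∀ k y a, P.SY k y a = families R k (Yout k y) a)
    (hsrc : ∀ k y a j, P.src k y a j = sources R k a j) (hSq : ∀ k y a j, P.Sq k y a j = countingCubes R k a j)
    (hSX : ∀ k y a j q, P.SX k y a j q = fibre R k a j q)
    (hvol : ∀ k y a, ∀ b ∈ P.SY k y a, P.vol k y a b = vol R k a b)
    (hdY : ∀ k y, 1 + R.carriers.d (Yout k y) ≤ P.dY k y)
    {κ κ₁ cQ θ ω : ℝ} (hκ : 144 ≤ κ) (hκ₁ : 69 ≤ κ₁) (hθ : 0 ≤ θ) (hper : (R.F.L : ℝ) ^ 4 * θ ^ 5 ≤ ω) (hw : (625 : ℝ) ≤ cQ) :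
    LevelCountsG P κ κ₁ (2 * (2 ^ 20 + 1)) cQ (fun k j => agePow θ k j ^ 5) (agePow ω) := by
  have h := levelCountsG_of_record₅_agePow R P (m := 2) Prod.fst (fun _ => rfl)
    (fun k y a j q Y => by rw [hSX]; exact multiplicity_fst_le_two _ Y)
    (fun k _ a j q => cubeAt R j q)
    (fun k y a j q x hx => by rw [hSX] at hx; exact fibre_reads k a j q x hx)
    hκ Yout (fun k y => by rw [hS0]; exact card_boxes_le k (Yout k y)) hdY hκ₁
    (fun k _ a => anchor R k a) (fun k _ _ b => cubesOf R k b)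
    (fun k y a => by rw [hSY]; exact injOn_cubesOf_families k (Yout k y) a)
    (fun k y a b hb => by
      rw [hSY] at hb
      obtain ⟨hA, hne, hC, -⟩ := cubesOf_of_mem_families hb
      exact ⟨hA, hne, hC⟩)
    (fun k _ a => anchor_nonempty_card_le k a)
    (fun k y a b hb => hvol k y a b hb)
    (fun k _ a => window R k a) (w := 625) (fun k _ a => card_window_le k a)
    (fun k y a j => by rw [hSq]; exact injOn_cubeAt_countingCubes k a j)
    (fun k y a j q hq => by rw [hSq] at hq; exact countingCubes_reads k a j q hq)
    (fun k y a j x hx => by rw [hsrc] at hx; exact sources_read k a j x hx)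
    (fun k y a j hjk hk b hb => by rw [hSq]; exact countingCubes_surj k a j hjk hk b hb)
    (fun k y a j q hq x hx hfp => by rw [hSX]; rw [hsrc] at hx; exact mem_fibre_of_mem_sources k a j hx hfp)
    hθ hper hw
  simpa using h

/-! ## §5 The size letter against the paid volume (for the species' G1 binder at this frame) -/

variable {R}

/-- [folklore] For a family `Y₀` of a box in `Y`: the scale-`k` cubes of `Y` number at most `vol + 6561 + 14641`
(`Y = Y₀ ∪ □̃⁵`, `Y₀ ⊆ (Y₀ ∖ □̃⁴) ∪ □̃⁴`). -/
theorem card_cubesAt_le_vol {k : ℕ} {Y : R.carriers.Dom} {a : SCube R} {b : Finset (SCube R)} (hb : b ∈ families R k Y a) :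
    ((cubesOf R k (footprint Y)).card : ℝ) ≤ vol R k a b + 6561 + 14641 := by
  obtain ⟨hA, -, -, hU⟩ := cubesOf_of_mem_families hb
  have h1 : (cubesOf R k (footprint Y)).card ≤ (cubesOf R k b).card + (box5 R k a).card := by
    rw [← hU]; exact Finset.card_union_le _ _
  have h2 : (cubesOf R k b).card ≤ (cubesOf R k b \ anchor R k a).card + (anchor R k a).card := by
    calc (cubesOf R k b).card ≤ ((cubesOf R k b \ anchor R k a) ∪ anchor R k a).card :=
          Finset.card_le_card (by rw [Finset.sdiff_union_of_subset hA])
      _ ≤ (cubesOf R k b \ anchor R k a).card + (anchor R k a).card := Finset.card_union_le _ _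
  have h3 := (anchor_nonempty_card_le k a).2
  have h4 := card_box5_le k a
  have : (cubesOf R k (footprint Y)).card ≤ (cubesOf R k b \ anchor R k a).card + 6561 + 14641 := by omega
  unfold vol
  exact_mod_cast this

/-- [folklore] For an output domain OF SCALE `k`, its scale-`k` cubes are its cubes: `cubesOf k (footprint ⟨k, Y⟩) = Y`. -/
theorem cubesOf_footprint_mk (k : ℕ) (Y : TDom 4 (R.cubesPerDir k)) :
    cubesOf R k (footprint (⟨k, Y⟩ : R.carriers.Dom)) = Y.1 := by
  ext p
  rw [mem_cubesOf, mk_mem_footprint_iff]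

/-- [folklore] The sources have the creation step of their slot (the species' source discipline `srcScale` at this frame). -/
theorem scale_of_mem_sources {k : ℕ} {a : SCube R} {j : ℕ} {x : R.carriers.Dom × Bool} (hx : x ∈ sources R k a j) :
    R.carriers.scale x.1 = j :=
  (TwoRuns.mem_domAt R).1 (mem_sources.1 hx).2.1

/-- [folklore] A box of scale `k` forces the output domain to be of scale `k`. -/
theorem fst_eq_of_mem_boxes {k : ℕ} {Y : R.carriers.Dom} {a : SCube R} (ha : a ∈ boxes R k Y) : Y.1 = k := by
  obtain ⟨haY, hak⟩ := mem_boxes.1 ha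
  rw [← fst_eq_of_mem_footprint haY, hak]

/-- **THE SIZE LETTER AGAINST THE PAID VOLUME** (the species' G1 binder `dY ≤ d₀ + 4·vol` at this frame, with `dY = 1 + d_k(Y)`):
for any box `□` of scale `k` in the output domain `Y` and any family `Y₀` of that box, `1 + d_k(Y) ≤ vol + 21203 ≤ 21203 + 4·vol`
— the torus tree length is at most `#cubes − 1` (`TreeLengthTorus.torusTreeLen_le_card_sub_one`) and `#cubes ≤ vol + 6561 + 14641`
(`Y = Y₀ ∪ □̃⁵`).  So G1 holds at this frame with `d₀ = 21203`. [cite: Balaban1988RG2Cluster, (1.25) p.7] -/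
theorem one_add_d_le_vol {k : ℕ} {Y : R.carriers.Dom} {a : SCube R} (ha : a ∈ boxes R k Y) {b : Finset (SCube R)}
    (hb : b ∈ families R k Y a) : 1 + R.carriers.d Y ≤ 21203 + 4 * vol R k a b := by
  obtain ⟨j, Z⟩ := Y
  have hj : j = k := fst_eq_of_mem_boxes ha
  subst hj
  have h1 := card_cubesAt_le_vol hb
  rw [cubesOf_footprint_mk] at h1
  have h2 : TreeLengthTorus.torusTreeLen Z.1 ≤ (Z.1.card : ℝ) - 1 := TreeLengthTorus.torusTreeLen_le_card_sub_one Z.2.1 Z.2.2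
  have h3 : 0 ≤ vol R j a b := by unfold vol; positivity
  rw [TwoRuns.carriers_d]
  change 1 + TreeLengthTorus.torusTreeLen Z.1 ≤ _
  linarith

end Record

end Summit.QuantumFields.BalabanUV.T4Continuum.NE9SpeciesFrameOfRecord

end
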